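import Literature.Analysis.FunctionSpaces.PolchinskiSemigroup
import Mathlib.Analysis.Calculus.MeanValue
import Mathlib.Analysis.Calculus.Deriv.Mul
import Mathlib.Analysis.Calculus.Deriv.Comp
import Mathlib.Algebra.Order.Chebyshev
import HarnessLib

/-!
# Gaussian convolution along a covariance decomposition solves the heat equation
# `∂_t E_{C_t}[G(φ+ζ)] = ½ E_{C_t}[(Δ_{Ċ_t} G)(φ+ζ)]` (Bauerschmidt–Bodineau–Dagallier, Proposition 5)

Topic `Literature/Analysis/FunctionSpaces`; second "proof architecture" file behind the named fact
`Polchinski.BauerschmidtBodineau_multiscaleBakryEmery` ([BBD] Theorem 3, `MultiscaleBakryEmery.lean`),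
after `PolchinskiSemigroup.lean` (the algebraic structure of §3.2).  This file PROVES the
differential input of §3.1–3.2: [BBD] **Proposition 5** — for a covariance decomposition
`C_t = ∫₀ᵗ Ċ_s ds` and `F_t(φ) = E_{C_t}[F(φ + ζ)]`, `∂_t F_t = ½ Δ_{Ċ_t} F_t` with
`Δ_C = Σ_{ij} C_{ij} ∂²/∂φ_i∂φ_j` ((e:DeltaC) p0012 L38–42; Prop 5 p0012 L60–75), «interpreted in a weak
sense if `C_t` is not strictly positive definite».  It is the time derivative behind the Polchinski
equation (Prop 7) and the generator `L_t` of the Polchinski semigroup (Prop 8), hence behind the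
entropy-production formula in the proof of Theorem 3.

We prove it for the DEGENERATE case directly (no density, no Itô formula — the two routes sketched
in [BBD] p0012 L77–95), in the finite-dimensional rendering `X = ℝ^N` of `MultiscaleBakryEmery.lean`
(`D : Polchinski.CovDecomposition N`: entrywise `C¹` matrices `C_t` with `Ċ_t ⪰ 0`), by the
elementary route: Gaussian decomposition `P_{C_{t+h}} = P_{C_t} ∗ P_{C_{t+h} − C_t}`
(`PolchinskiSemigroup.lean`), a second-order Taylor expansion of `G` along segments, the Gaussian
moments `E_D[w] = 0`, `E_D[w_i w_j] = D_{ij}`, and a fourth-moment scaling bound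
`E_D‖w‖⁴ ≤ (Σ|D_{ij}|)² E‖z‖⁴` obtained from Mathlib's definition `P_D = (√D)_* P_{Id}`.

## Main results (sorry-free; no new definitions, no new named facts)

* `abs_integral_sub_sub_half_sum_le` — ONE SMOOTHING STEP: for `G` bounded with first/second
  Fréchet derivatives `D1`, `D2`, `‖D2‖ ≤ M` and `(ε,δ)`-uniformly continuous, and `S ⪰ 0`:
  `|E_S[G(y+w) − G(y)] − ½ Σ_{ij} S_{ij} D²G(y)(e_i,e_j)| ≤ ε tr S + 2Mδ⁻² (Σ_{ij}|S_{ij}|)² E‖z‖⁴`.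
* `abs_integral_shift_sub_le` — weak continuity `|E_S[H(y+w)] − H(y)| ≤ ε + 2M_Hδ⁻² tr S`.
* `integral_gaussian_C_sub_eq`, `abs_integral_C_sub_integral_C_sub_sum_le` — the two-scale forms
  along `D`: `E_{C_{s'}}G − E_{C_s}G = E_{C_s}[E_{C_{s'}−C_s}[G(·+w) − G]]` and its second-order
  expansion, `0 ≤ s ≤ s'`.
* `tendsto_integral_gaussian_Ici` — continuity of `t ↦ E_{C_t}[H(φ+ζ)]` on `[0,∞)`.
* **`hasDerivWithinAt_integral_gaussian_Ici`** (right derivative at every `t ≥ 0`),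
  **`hasDerivWithinAt_integral_gaussian_Iic`** (left derivative at `t > 0`) and
  **`hasDerivAt_integral_gaussian`** ([BBD] Prop 5 at `t > 0`):
  `d/dt E_{C_t}[G(φ+ζ)] = ½ Σ_{ij} Ċ_t^{ij} E_{C_t}[D²G(φ+ζ)(e_i,e_j)]`.

Hypotheses beyond the printed «`C²`»: `G` bounded and `D²G` bounded and uniformly continuous (true
for `e^{−V₀}` when `V₀` is bounded below with bounded, uniformly continuous first and second
derivatives — the use in Prop 7).  At `t = 0` only the right derivative is asserted: the structure
`CovDecomposition` constrains `C_t` for `t ≥ 0` only.  What is NOT here: Prop 7 (Polchinski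
equation) and the spatial derivatives of `F_t` (differentiation under the Gaussian integral),
the generator identities of Prop 8, Theorem 3.  Nothing here concerns Yang–Mills.

## References

* [BauerschmidtBodineauDagallier2023] R. Bauerschmidt, T. Bodineau, B. Dagallier, *Stochastic
  dynamics and the Polchinski equation: an introduction*, Probab. Surveys 21 (2024) 200–290,
  arXiv:2307.07619 — §3.1 (e:DeltaC), (e:Gauss-conv), Proposition 5 and its proof sketch p0012.
  READ (held text `paper:arxiv-2307.07619`).
* [BauerschmidtBodineau2021SineGordonLSI] R. Bauerschmidt, T. Bodineau, CPAM 74 (2021), §2.4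
  («by a well-known computation … the Gaussian convolution acts as the heat semigroup with
  time-dependent generator `½Δ_{Ċ_t}`», `paper:arxiv-1907.12308` p0010 L70–78). READ.
-/

noncomputable section

open MeasureTheory ProbabilityTheory Filter Topology Set
open scoped RealInnerProductSpace Matrix MatrixOrder

namespace Literature.Analysis.FunctionSpaces

namespace Polchinski

/-! ### Second-order Taylor estimate along a segment -/

section Taylor

variable {E : Type*} [NormedAddCommGroup E] [NormedSpace ℝ E]

/-- Derivative of `τ ↦ G(y + τ•w)`. [folklore] -/
private theorem hasDerivAt_comp_line {G : E → ℝ} {D1 : E → E →L[ℝ] ℝ}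
    (h1 : ∀ x, HasFDerivAt G (D1 x) x) (y w : E) (τ : ℝ) :
    HasDerivAt (fun σ : ℝ => G (y + σ • w)) (D1 (y + τ • w) w) τ := by
  have hl : HasDerivAt (fun σ : ℝ => y + σ • w) w τ := by
    simpa using ((hasDerivAt_id τ).smul_const w).const_add y
  exact (h1 (y + τ • w)).comp_hasDerivAt τ hl

/-- Derivative of `τ ↦ DG(y + τ•w) w`. [folklore] -/
private theorem hasDerivAt_fderiv_comp_line {D1 : E → E →L[ℝ] ℝ} {D2 : E → E →L[ℝ] E →L[ℝ] ℝ}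
    (h2 : ∀ x, HasFDerivAt D1 (D2 x) x) (y w : E) (τ : ℝ) :
    HasDerivAt (fun σ : ℝ => D1 (y + σ • w) w) (D2 (y + τ • w) w w) τ := by
  have hl : HasDerivAt (fun σ : ℝ => y + σ • w) w τ := by
    simpa using ((hasDerivAt_id τ).smul_const w).const_add y
  have hc : HasDerivAt (fun σ : ℝ => D1 (y + σ • w)) (D2 (y + τ • w) w) τ :=
    (h2 (y + τ • w)).comp_hasDerivAt τ hl
  have h := (ContinuousLinearMap.apply ℝ ℝ w).hasFDerivAt.comp_hasDerivAt τ hc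
  simpa only [Function.comp_def, ContinuousLinearMap.apply_apply] using h

/-- **Second-order Taylor estimate along a segment.**  If `G : E → ℝ` has first and second
Fréchet derivatives `D1`, `D2` everywhere and `‖D2(y + σw) − D2(y)‖ ≤ ω` for all `σ ∈ [0,1]`, then
`|G(y+w) − G(y) − D1(y)w − ½ D2(y)(w,w)| ≤ ω ‖w‖²` (two applications of the mean-value inequality).
[folklore] -/
private theorem taylor_two_segment {G : E → ℝ} {D1 : E → E →L[ℝ] ℝ}
    {D2 : E → E →L[ℝ] E →L[ℝ] ℝ}
    (h1 : ∀ x, HasFDerivAt G (D1 x) x) (h2 : ∀ x, HasFDerivAt D1 (D2 x) x)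
    (y w : E) {ω : ℝ} (hω : ∀ σ ∈ Icc (0:ℝ) 1, ‖D2 (y + σ • w) - D2 y‖ ≤ ω) :
    |G (y + w) - G y - D1 y w - (1 / 2) * D2 y w w| ≤ ω * ‖w‖ ^ 2 := by
  have hω0 : 0 ≤ ω := le_trans (norm_nonneg (D2 (y + (0:ℝ) • w) - D2 y)) (hω 0 (by simp))
  -- first level: f₂ σ = D1(y+σw) w − σ D2(y) w w
  set f₂ : ℝ → ℝ := fun σ => D1 (y + σ • w) w - σ * D2 y w w with hf₂
  have hf₂' : ∀ σ, HasDerivAt f₂ (D2 (y + σ • w) w w - D2 y w w) σ := by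
    intro σ
    have h := (hasDerivAt_fderiv_comp_line h2 y w σ).fun_sub
      ((hasDerivAt_id σ).mul_const (D2 y w w))
    rw [one_mul] at h
    exact h
  have hb₂ : ∀ σ ∈ Icc (0:ℝ) 1, ‖D2 (y + σ • w) w w - D2 y w w‖ ≤ ω * ‖w‖ ^ 2 := by
    intro σ hσ
    have h : D2 (y + σ • w) w w - D2 y w w = (D2 (y + σ • w) - D2 y) w w := by
      simp only [sub_apply]
    rw [h]
    calc ‖(D2 (y + σ • w) - D2 y) w w‖ ≤ ‖(D2 (y + σ • w) - D2 y) w‖ * ‖w‖ :=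
          ContinuousLinearMap.le_opNorm _ _
      _ ≤ ‖D2 (y + σ • w) - D2 y‖ * ‖w‖ * ‖w‖ :=
          mul_le_mul_of_nonneg_right (ContinuousLinearMap.le_opNorm _ _) (norm_nonneg _)
      _ ≤ ω * ‖w‖ * ‖w‖ := by gcongr; exact hω σ hσ
      _ = ω * ‖w‖ ^ 2 := by ring
  have hmv₂ : ∀ τ ∈ Icc (0:ℝ) 1, ‖f₂ τ - f₂ 0‖ ≤ ω * ‖w‖ ^ 2 * (τ - 0) :=
    norm_image_sub_le_of_norm_deriv_le_segment' (fun σ _ => (hf₂' σ).hasDerivWithinAt)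
      (fun σ hσ => hb₂ σ (Ico_subset_Icc_self hσ))
  -- second level: f₁ τ = G(y+τw) − τ D1(y) w − τ²/2 D2(y) w w
  set f₁ : ℝ → ℝ := fun τ => G (y + τ • w) - τ * D1 y w - τ ^ 2 / 2 * D2 y w w with hf₁
  have hf₁' : ∀ τ, HasDerivAt f₁ (f₂ τ - f₂ 0) τ := by
    intro τ
    have h := ((hasDerivAt_comp_line h1 y w τ).fun_sub ((hasDerivAt_id τ).mul_const (D1 y w))).fun_sub
      (((hasDerivAt_id τ).fun_pow 2).div_const 2 |>.mul_const (D2 y w w))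
    have e : f₂ τ - f₂ 0 = D1 (y + τ • w) w - 1 * D1 y w - (↑2 * id τ ^ (2 - 1) * 1) / 2 * D2 y w w := by
      simp [hf₂]; ring
    rw [e]
    exact h
  have hb₁ : ∀ τ ∈ Ico (0:ℝ) 1, ‖f₂ τ - f₂ 0‖ ≤ ω * ‖w‖ ^ 2 := by
    intro τ hτ
    have h := hmv₂ τ (Ico_subset_Icc_self hτ)
    have hτ1 : τ - 0 ≤ 1 := by linarith [hτ.2]
    calc ‖f₂ τ - f₂ 0‖ ≤ ω * ‖w‖ ^ 2 * (τ - 0) := h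
      _ ≤ ω * ‖w‖ ^ 2 * 1 := by gcongr
      _ = ω * ‖w‖ ^ 2 := mul_one _
  have hmv₁ := norm_image_sub_le_of_norm_deriv_le_segment' (fun τ _ => (hf₁' τ).hasDerivWithinAt)
    hb₁ 1 (by simp)
  have e1 : f₁ 1 - f₁ 0 = G (y + w) - G y - D1 y w - (1 / 2) * D2 y w w := by
    simp [hf₁]; ring
  rw [e1, Real.norm_eq_abs] at hmv₁
  simpa using hmv₁

end Taylor

/-! ### Gaussian moments for a (possibly degenerate) centred Gaussian on `ℝ^N` -/

section Moments

variable {ι : Type*} [Fintype ι] [DecidableEq ι]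

/-- First moments vanish: `E_D[L(w)] = 0` for a continuous linear functional `L`. [folklore] -/
private theorem integral_clm_gaussian_eq_zero (S : Matrix ι ι ℝ) (L : EuclideanSpace ℝ ι →L[ℝ] ℝ) :
    ∫ w, L w ∂(multivariateGaussian 0 S) = 0 := by
  rw [L.integral_comp_id_comm IsGaussian.integrable_id, integral_id_multivariateGaussian, map_zero]

/-- Second moments: `E_D[w_i w_j] = D_{ij}` for positive semidefinite `D`. [folklore] -/
private theorem integral_eval_mul_eval_gaussian {S : Matrix ι ι ℝ} (hS : S.PosSemidef) (i j : ι) :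
    ∫ w, w i * w j ∂(multivariateGaussian 0 S) = S i j := by
  have hcov := covariance_eval_multivariateGaussian (μ := 0) hS i j
  have hmem : ∀ k : ι, MemLp (fun x : EuclideanSpace ℝ ι => x k) 2 (multivariateGaussian 0 S) := by
    intro k
    have h := (EuclideanSpace.proj (𝕜 := ℝ) k).comp_memLp' (IsGaussian.memLp_id
      (multivariateGaussian 0 S) 2 (by simp))
    simpa using h
  have hmean : ∀ k : ι, ∫ x, x k ∂(multivariateGaussian 0 S) = 0 := by
    intro k
    have h := integral_clm_gaussian_eq_zero S (EuclideanSpace.proj (𝕜 := ℝ) k)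
    simpa using h
  rw [covariance_eq_sub (hmem i) (hmem j)] at hcov
  simpa [hmean] using hcov

/-- `E_D[‖w‖²] = Σ_i D_{ii}` for positive semidefinite `D`. [folklore] -/
private theorem integral_norm_sq_gaussian {S : Matrix ι ι ℝ} (hS : S.PosSemidef) :
    ∫ w, ‖w‖ ^ 2 ∂(multivariateGaussian 0 S) = ∑ i, S i i := by
  simp_rw [EuclideanSpace.real_norm_sq_eq]
  rw [integral_finsetSum]
  · refine Finset.sum_congr rfl fun i _ => ?_
    have h := integral_eval_mul_eval_gaussian hS i i
    simpa [pow_two] using h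
  · intro i _
    have hmem : MemLp (fun x : EuclideanSpace ℝ ι => x i) 2 (multivariateGaussian 0 S) := by
      have h := (EuclideanSpace.proj (𝕜 := ℝ) i).comp_memLp' (IsGaussian.memLp_id
        (multivariateGaussian 0 S) 2 (by simp))
      simpa using h
    exact hmem.integrable_sq

/-- Coordinates are square integrable under a Gaussian. [folklore] -/
private theorem memLp_two_eval_gaussian (S : Matrix ι ι ℝ) (k : ι) :
    MemLp (fun x : EuclideanSpace ℝ ι => x k) 2 (multivariateGaussian 0 S) := by
  have h := (EuclideanSpace.proj (𝕜 := ℝ) k).comp_memLp' (IsGaussian.memLp_id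
    (multivariateGaussian 0 S) 2 (by simp))
  simpa using h

/-- A continuous bilinear form evaluated on the diagonal expands in coordinates:
`B(w,w) = Σ_i Σ_j w_i w_j B(e_i, e_j)`. [folklore] -/
private theorem bilin_apply_eq_sum (B : EuclideanSpace ℝ ι →L[ℝ] EuclideanSpace ℝ ι →L[ℝ] ℝ)
    (w : EuclideanSpace ℝ ι) :
    B w w = ∑ i, ∑ j, w i * w j * B (EuclideanSpace.single i 1) (EuclideanSpace.single j 1) := by
  have hw : w = ∑ i, w i • EuclideanSpace.single i (1:ℝ) := by
    have h := (EuclideanSpace.basisFun ι ℝ).sum_repr w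
    simp only [EuclideanSpace.basisFun_repr, EuclideanSpace.basisFun_apply] at h
    exact h.symm
  conv_lhs => rw [hw]
  simp only [map_sum, map_smul, _root_.sum_apply, _root_.smul_apply, smul_eq_mul, Finset.mul_sum]
  conv_rhs => rw [Finset.sum_comm]
  refine Finset.sum_congr rfl fun i _ => Finset.sum_congr rfl fun j _ => ?_
  ring

/-- **Second moments of a bilinear form**: `E_D[B(w,w)] = Σ_{ij} D_{ij} B(e_i,e_j)` for positive
semidefinite `D`. [folklore] -/
private theorem integral_bilin_gaussian {S : Matrix ι ι ℝ} (hS : S.PosSemidef)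
    (B : EuclideanSpace ℝ ι →L[ℝ] EuclideanSpace ℝ ι →L[ℝ] ℝ) :
    ∫ w, B w w ∂(multivariateGaussian 0 S) =
      ∑ i, ∑ j, S i j * B (EuclideanSpace.single i 1) (EuclideanSpace.single j 1) := by
  simp_rw [bilin_apply_eq_sum B]
  have hint : ∀ i j, Integrable (fun w : EuclideanSpace ℝ ι => w i * w j)
      (multivariateGaussian 0 S) := fun i j =>
    (memLp_two_eval_gaussian S i).integrable_mul (memLp_two_eval_gaussian S j)
  rw [integral_finsetSum _ fun i _ => integrable_finsetSum _ fun j _ => (hint i j).mul_const _]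
  refine Finset.sum_congr rfl fun i _ => ?_
  rw [integral_finsetSum _ fun j _ => (hint i j).mul_const _]
  refine Finset.sum_congr rfl fun j _ => ?_
  rw [integral_mul_const, integral_eval_mul_eval_gaussian hS i j]

omit [DecidableEq ι] in
/-- The quadratic form of a real matrix is dominated by `(Σ_{ij} |S_{ij}|) ‖z‖²`. [folklore] -/
private theorem dotProduct_mulVec_le_sum_abs_mul_norm_sq (S : Matrix ι ι ℝ) (z : EuclideanSpace ℝ ι) :
    WithLp.ofLp z ⬝ᵥ S *ᵥ WithLp.ofLp z ≤ (∑ i, ∑ j, |S i j|) * ‖z‖ ^ 2 := by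
  have hz : ∀ i, |z i| ≤ ‖z‖ := fun i => by
    simpa [Real.norm_eq_abs] using PiLp.norm_apply_le z i
  simp only [dotProduct, Matrix.mulVec, Finset.mul_sum, Finset.sum_mul]
  refine Finset.sum_le_sum fun i _ => Finset.sum_le_sum fun j _ => ?_
  have h1 : WithLp.ofLp z i * (S i j * WithLp.ofLp z j) = S i j * (z i * z j) := by ring
  rw [h1]
  calc S i j * (z i * z j) ≤ |S i j * (z i * z j)| := le_abs_self _
    _ = |S i j| * (|z i| * |z j|) := by rw [abs_mul, abs_mul]
    _ ≤ |S i j| * (‖z‖ * ‖z‖) := by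
        gcongr
        exacts [hz i, hz j]
    _ = |S i j| * ‖z‖ ^ 2 := by ring

/-- `‖√S z‖² = (z, S z)` for positive semidefinite `S` (self-adjointness of `√S` and `√S √S = S`).
[folklore] -/
private theorem norm_sqrt_apply_sq {S : Matrix ι ι ℝ} (hS : S.PosSemidef) (z : EuclideanSpace ℝ ι) :
    ‖Matrix.toEuclideanCLM (𝕜 := ℝ) (CFC.sqrt S) z‖ ^ 2 = WithLp.ofLp z ⬝ᵥ S *ᵥ WithLp.ofLp z := by
  set T := Matrix.toEuclideanCLM (𝕜 := ℝ) (CFC.sqrt S) with hT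
  have hsa : IsSelfAdjoint T := (CFC.sqrt_nonneg S).isSelfAdjoint.map _
  rw [← real_inner_self_eq_norm_sq, ← ContinuousLinearMap.adjoint_inner_right, hsa.adjoint_eq,
    ← ContinuousLinearMap.comp_apply, ← ContinuousLinearMap.mul_def, hT, ← map_mul,
    CFC.sqrt_mul_sqrt_self _ hS.nonneg, Matrix.inner_toEuclideanCLM]

/-- **Fourth-moment scaling bound**: `E_D[‖w‖⁴] ≤ (Σ_{ij}|D_{ij}|)² · E[‖z‖⁴]` with `z` standard
Gaussian (the Gaussian `P_D` is the image of the standard one under `√D`). [folklore] -/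
private theorem integral_norm_pow_four_gaussian_le {S : Matrix ι ι ℝ} (hS : S.PosSemidef) :
    ∫ w, ‖w‖ ^ 4 ∂(multivariateGaussian 0 S) ≤
      (∑ i, ∑ j, |S i j|) ^ 2 * ∫ z, ‖z‖ ^ 4 ∂(stdGaussian (EuclideanSpace ℝ ι)) := by
  set T := Matrix.toEuclideanCLM (𝕜 := ℝ) (CFC.sqrt S) with hT
  have hmeas : AEMeasurable (fun x : EuclideanSpace ℝ ι => (0 : EuclideanSpace ℝ ι) + T x)
      (stdGaussian (EuclideanSpace ℝ ι)) := by fun_prop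
  rw [multivariateGaussian, integral_map hmeas (by fun_prop), ← integral_const_mul]
  have h4 : Integrable (fun z : EuclideanSpace ℝ ι => ‖z‖ ^ 4) (stdGaussian (EuclideanSpace ℝ ι)) :=
    (IsGaussian.memLp_id _ 4 (by simp)).integrable_norm_pow (by norm_num)
  refine integral_mono_of_nonneg (Eventually.of_forall fun z => by positivity)
    (h4.const_mul _) (Eventually.of_forall fun z => ?_)
  simp only [zero_add]
  have hsq : ‖T z‖ ^ 2 ≤ (∑ i, ∑ j, |S i j|) * ‖z‖ ^ 2 := by
    rw [hT, norm_sqrt_apply_sq hS z]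
    exact dotProduct_mulVec_le_sum_abs_mul_norm_sq S z
  have h0 : 0 ≤ ‖T z‖ ^ 2 := by positivity
  calc ‖T z‖ ^ 4 = (‖T z‖ ^ 2) ^ 2 := by ring
    _ ≤ ((∑ i, ∑ j, |S i j|) * ‖z‖ ^ 2) ^ 2 := pow_le_pow_left₀ h0 hsq 2
    _ = (∑ i, ∑ j, |S i j|) ^ 2 * ‖z‖ ^ 4 := by ring

end Moments

/-! ### One Gaussian smoothing step of small covariance: second-order expansion -/

section Step

variable {ι : Type*} [Fintype ι] [DecidableEq ι]

/-- Pointwise remainder bound from a bounded, `(ε,δ)`-uniformly-continuous Hessian: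
`|G(y+w) − G(y) − DG(y)w − ½D²G(y)(w,w)| ≤ ε‖w‖² + 2M δ⁻² ‖w‖⁴`. [folklore] -/
private theorem abs_taylor_remainder_le {E : Type*} [NormedAddCommGroup E] [NormedSpace ℝ E]
    {G : E → ℝ} {D1 : E → E →L[ℝ] ℝ} {D2 : E → E →L[ℝ] E →L[ℝ] ℝ}
    (h1 : ∀ x, HasFDerivAt G (D1 x) x) (h2 : ∀ x, HasFDerivAt D1 (D2 x) x)
    {M : ℝ} (hM : ∀ x, ‖D2 x‖ ≤ M) {ε δ : ℝ} (hδ : 0 < δ)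
    (hUC : ∀ x y, ‖x - y‖ < δ → ‖D2 x - D2 y‖ ≤ ε) (y w : E) :
    |G (y + w) - G y - D1 y w - (1 / 2) * D2 y w w| ≤ ε * ‖w‖ ^ 2 + 2 * M / δ ^ 2 * ‖w‖ ^ 4 := by
  have hM0 : 0 ≤ M := le_trans (norm_nonneg (D2 y)) (hM y)
  have hε0 : 0 ≤ ε := le_trans (norm_nonneg (D2 y - D2 y)) (hUC y y (by simpa using hδ))
  by_cases hw : ‖w‖ < δ
  · have hb : ∀ σ ∈ Icc (0:ℝ) 1, ‖D2 (y + σ • w) - D2 y‖ ≤ ε := by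
      intro σ hσ
      refine hUC _ _ ?_
      rw [add_sub_cancel_left, norm_smul, Real.norm_eq_abs, abs_of_nonneg hσ.1]
      calc σ * ‖w‖ ≤ 1 * ‖w‖ := by gcongr; exact hσ.2
        _ = ‖w‖ := one_mul _
        _ < δ := hw
    have h := taylor_two_segment h1 h2 y w hb
    have : 0 ≤ 2 * M / δ ^ 2 * ‖w‖ ^ 4 := by positivity
    linarith
  · rw [not_lt] at hw
    have hb : ∀ σ ∈ Icc (0:ℝ) 1, ‖D2 (y + σ • w) - D2 y‖ ≤ 2 * M := by
      intro σ _
      calc ‖D2 (y + σ • w) - D2 y‖ ≤ ‖D2 (y + σ • w)‖ + ‖D2 y‖ :=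
            norm_sub_le (D2 (y + σ • w)) (D2 y)
        _ ≤ M + M := add_le_add (hM _) (hM _)
        _ = 2 * M := by ring
    have h := taylor_two_segment h1 h2 y w hb
    have hw2 : δ ^ 2 ≤ ‖w‖ ^ 2 := pow_le_pow_left₀ hδ.le hw 2
    have hkey : 2 * M * ‖w‖ ^ 2 ≤ 2 * M / δ ^ 2 * ‖w‖ ^ 4 := by
      rw [div_mul_eq_mul_div, le_div_iff₀ (by positivity)]
      calc 2 * M * ‖w‖ ^ 2 * δ ^ 2 ≤ 2 * M * ‖w‖ ^ 2 * ‖w‖ ^ 2 := by gcongr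
        _ = 2 * M * ‖w‖ ^ 4 := by ring
    have : 0 ≤ ε * ‖w‖ ^ 2 := by positivity
    linarith

/-- **One Gaussian smoothing step, second-order expansion.**  For `G` bounded with first and
second Fréchet derivatives everywhere, Hessian bounded by `M` and `(ε,δ)`-uniformly continuous, and a
positive semidefinite `S`:
`|E_S[G(y+w) − G(y)] − ½ Σ_{ij} S_{ij} D²G(y)(e_i,e_j)| ≤ ε Σ_i S_{ii} + 2Mδ⁻² (Σ_{ij}|S_{ij}|)² E[‖z‖⁴]`
(`z` standard Gaussian).  This is the infinitesimal form of [BBD] Proposition 5.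
[cite: BauerschmidtBodineauDagallier2023, Proposition 5 (proof)] -/
theorem abs_integral_sub_sub_half_sum_le {G : EuclideanSpace ℝ ι → ℝ}
    {D1 : EuclideanSpace ℝ ι → EuclideanSpace ℝ ι →L[ℝ] ℝ}
    {D2 : EuclideanSpace ℝ ι → EuclideanSpace ℝ ι →L[ℝ] EuclideanSpace ℝ ι →L[ℝ] ℝ}
    (h1 : ∀ x, HasFDerivAt G (D1 x) x) (h2 : ∀ x, HasFDerivAt D1 (D2 x) x)
    {K0 : ℝ} (hG : ∀ x, |G x| ≤ K0) {M : ℝ} (hM : ∀ x, ‖D2 x‖ ≤ M) {ε δ : ℝ} (hδ : 0 < δ)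
    (hUC : ∀ x y, ‖x - y‖ < δ → ‖D2 x - D2 y‖ ≤ ε) {S : Matrix ι ι ℝ} (hS : S.PosSemidef)
    (y : EuclideanSpace ℝ ι) :
    |(∫ w, (G (y + w) - G y) ∂(multivariateGaussian 0 S)) -
        (1 / 2) * ∑ i, ∑ j, S i j * D2 y (EuclideanSpace.single i 1) (EuclideanSpace.single j 1)| ≤
      ε * ∑ i, S i i + 2 * M / δ ^ 2 * ((∑ i, ∑ j, |S i j|) ^ 2 *
        ∫ z, ‖z‖ ^ 4 ∂(stdGaussian (EuclideanSpace ℝ ι))) := by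
  set P := multivariateGaussian 0 S with hP
  have hGc : Continuous G := continuous_iff_continuousAt.2 fun x => (h1 x).continuousAt
  have hGm : Measurable G := hGc.measurable
  -- integrability of the pieces
  have hI0 : Integrable (fun w => G (y + w) - G y) P :=
    (Integrable.of_bound (hGm.comp (measurable_const_add y)).aestronglyMeasurable K0
      (Eventually.of_forall fun w => by simpa [Real.norm_eq_abs] using hG (y + w))).sub
      (integrable_const _)
  have hI1 : Integrable (fun w : EuclideanSpace ℝ ι => D1 y w) P :=
    (D1 y).integrable_comp IsGaussian.integrable_id
  have h2m : Integrable (fun w : EuclideanSpace ℝ ι => ‖w‖ ^ 2) P :=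
    (IsGaussian.memLp_id P 2 (by simp)).integrable_norm_pow (by norm_num)
  have h4m : Integrable (fun w : EuclideanSpace ℝ ι => ‖w‖ ^ 4) P :=
    (IsGaussian.memLp_id P 4 (by simp)).integrable_norm_pow (by norm_num)
  have hI2 : Integrable (fun w : EuclideanSpace ℝ ι => (1 / 2) * D2 y w w) P := by
    have hc : Continuous fun w : EuclideanSpace ℝ ι => D2 y w w :=
      (D2 y).continuous₂.comp (continuous_id.prodMk continuous_id)
    refine ((h2m.const_mul ‖D2 y‖).const_mul (1 / 2)).mono'
      (continuous_const.mul hc).aestronglyMeasurable ?_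
    · refine Eventually.of_forall fun w => ?_
      rw [Real.norm_eq_abs, abs_mul, abs_of_nonneg (by norm_num : (0:ℝ) ≤ 1 / 2)]
      refine mul_le_mul_of_nonneg_left ?_ (by norm_num)
      calc |D2 y w w| ≤ ‖D2 y w‖ * ‖w‖ := by
            rw [← Real.norm_eq_abs]; exact ContinuousLinearMap.le_opNorm _ _
        _ ≤ ‖D2 y‖ * ‖w‖ * ‖w‖ :=
            mul_le_mul_of_nonneg_right (ContinuousLinearMap.le_opNorm _ _) (norm_nonneg _)
        _ = ‖D2 y‖ * ‖w‖ ^ 2 := by ring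
  -- the remainder
  set R : EuclideanSpace ℝ ι → ℝ := fun w => G (y + w) - G y - D1 y w - (1 / 2) * D2 y w w with hR
  have hRint : Integrable R P := (hI0.sub hI1).sub hI2
  have hRle : ∀ w, |R w| ≤ ε * ‖w‖ ^ 2 + 2 * M / δ ^ 2 * ‖w‖ ^ 4 := fun w =>
    abs_taylor_remainder_le h1 h2 hM hδ hUC y w
  -- decomposition of the integral
  have hdec : (∫ w, (G (y + w) - G y) ∂P) =
      (∫ w, R w ∂P) + (∫ w, D1 y w ∂P) + ∫ w, (1 / 2) * D2 y w w ∂P := by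
    have e : (fun w => G (y + w) - G y) = fun w => (R w + D1 y w) + (1 / 2) * D2 y w w := by
      funext w; simp only [hR]; ring
    have hA : Integrable (fun w => R w + D1 y w) P := hRint.add hI1
    rw [e, integral_add hA hI2, integral_add hRint hI1]
  have hlin : (∫ w, D1 y w ∂P) = 0 := integral_clm_gaussian_eq_zero S (D1 y)
  have hquad : (∫ w, (1 / 2) * D2 y w w ∂P) =
      (1 / 2) * ∑ i, ∑ j, S i j * D2 y (EuclideanSpace.single i 1) (EuclideanSpace.single j 1) := by
    rw [integral_const_mul, integral_bilin_gaussian hS (D2 y)]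
  rw [hdec, hlin, add_zero, hquad, add_sub_cancel_right]
  -- bound the remainder integral
  calc |∫ w, R w ∂P| ≤ ∫ w, |R w| ∂P := abs_integral_le_integral_abs
    _ ≤ ∫ w, (ε * ‖w‖ ^ 2 + 2 * M / δ ^ 2 * ‖w‖ ^ 4) ∂P :=
        integral_mono hRint.abs ((h2m.const_mul ε).add (h4m.const_mul _)) hRle
    _ = ε * ∫ w, ‖w‖ ^ 2 ∂P + 2 * M / δ ^ 2 * ∫ w, ‖w‖ ^ 4 ∂P := by
        rw [integral_add (h2m.const_mul ε) (h4m.const_mul _), integral_const_mul, integral_const_mul]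
    _ ≤ ε * ∑ i, S i i + 2 * M / δ ^ 2 * ((∑ i, ∑ j, |S i j|) ^ 2 *
          ∫ z, ‖z‖ ^ 4 ∂(stdGaussian (EuclideanSpace ℝ ι))) := by
        rw [hP, integral_norm_sq_gaussian hS]
        have hM0 : 0 ≤ M := le_trans (norm_nonneg (D2 y)) (hM y)
        have h4 := integral_norm_pow_four_gaussian_le hS
        gcongr

/-- **Weak continuity of Gaussian smoothing**: for `H` bounded by `M_H` and `(ε,δ)`-uniformly
continuous and `S` positive semidefinite, `|E_S[H(y+w)] − H(y)| ≤ ε + 2 M_H δ⁻² Σ_i S_{ii}`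
(the weak convergence `P_{C} → δ_0` as `C → 0` used for `P_{t,t} = id` in [BBD] Prop 8, made
quantitative). [cite: BauerschmidtBodineauDagallier2023, Proposition 8 (proof)] -/
theorem abs_integral_shift_sub_le {H : EuclideanSpace ℝ ι → ℝ} (hHm : Measurable H)
    {MH : ℝ} (hH : ∀ x, |H x| ≤ MH) {ε δ : ℝ} (hδ : 0 < δ)
    (hUC : ∀ x y, ‖x - y‖ < δ → |H x - H y| ≤ ε) {S : Matrix ι ι ℝ} (hS : S.PosSemidef)
    (y : EuclideanSpace ℝ ι) :
    |(∫ w, H (y + w) ∂(multivariateGaussian 0 S)) - H y| ≤ ε + 2 * MH / δ ^ 2 * ∑ i, S i i := by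
  set P := multivariateGaussian 0 S with hP
  have hMH0 : 0 ≤ MH := le_trans (abs_nonneg _) (hH y)
  have hε0 : 0 ≤ ε := le_trans (abs_nonneg _) (hUC y y (by simpa using hδ))
  have hI : Integrable (fun w => H (y + w)) P :=
    Integrable.of_bound (hHm.comp (measurable_const_add y)).aestronglyMeasurable MH
      (Eventually.of_forall fun w => by simpa [Real.norm_eq_abs] using hH (y + w))
  have h2m : Integrable (fun w : EuclideanSpace ℝ ι => ‖w‖ ^ 2) P :=
    (IsGaussian.memLp_id P 2 (by simp)).integrable_norm_pow (by norm_num)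
  have hpt : ∀ w, |H (y + w) - H y| ≤ ε + 2 * MH / δ ^ 2 * ‖w‖ ^ 2 := by
    intro w
    by_cases hw : ‖w‖ < δ
    · have h := hUC (y + w) y (by simpa using hw)
      have : 0 ≤ 2 * MH / δ ^ 2 * ‖w‖ ^ 2 := by positivity
      linarith
    · rw [not_lt] at hw
      have hw2 : δ ^ 2 ≤ ‖w‖ ^ 2 := pow_le_pow_left₀ hδ.le hw 2
      have hb : |H (y + w) - H y| ≤ 2 * MH := by
        calc |H (y + w) - H y| ≤ |H (y + w)| + |H y| := abs_sub _ _
          _ ≤ MH + MH := add_le_add (hH _) (hH _)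
          _ = 2 * MH := by ring
      have hkey : 2 * MH ≤ 2 * MH / δ ^ 2 * ‖w‖ ^ 2 := by
        rw [div_mul_eq_mul_div, le_div_iff₀ (by positivity)]
        gcongr
      linarith
  have hsub : (∫ w, H (y + w) ∂P) - H y = ∫ w, (H (y + w) - H y) ∂P := by
    rw [integral_sub hI (integrable_const _), integral_const, probReal_univ, one_smul]
  rw [hsub]
  calc |∫ w, (H (y + w) - H y) ∂P| ≤ ∫ w, |H (y + w) - H y| ∂P := abs_integral_le_integral_abs
    _ ≤ ∫ w, (ε + 2 * MH / δ ^ 2 * ‖w‖ ^ 2) ∂P :=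
        integral_mono (hI.sub (integrable_const _)).abs ((integrable_const ε).add (h2m.const_mul _))
          hpt
    _ = ε + 2 * MH / δ ^ 2 * ∑ i, S i i := by
        rw [integral_add (integrable_const ε) (h2m.const_mul _), integral_const,
          probReal_univ, one_smul, integral_const_mul, hP, integral_norm_sq_gaussian hS]

end Step

/-! ### The heat equation along a covariance decomposition ([BBD] Proposition 5) -/

section Heat

variable {N : ℕ} (D : CovDecomposition N)

/-- Bounded continuous functions are integrable against a Gaussian, and their partial Gaussian
averages `x ↦ E_B[G(φ+x+w)]` are measurable and bounded. [folklore] -/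
private theorem integrable_shift_of_bounded {G : EuclideanSpace ℝ (Fin N) → ℝ} (hGm : Measurable G)
    {K0 : ℝ} (hG : ∀ x, |G x| ≤ K0) (P : Measure (EuclideanSpace ℝ (Fin N))) [IsFiniteMeasure P]
    (φ : EuclideanSpace ℝ (Fin N)) : Integrable (fun x => G (φ + x)) P :=
  Integrable.of_bound (hGm.comp (measurable_const_add φ)).aestronglyMeasurable K0
    (Eventually.of_forall fun w => by simpa [Real.norm_eq_abs] using hG (φ + w))

/-- Measurability of the inner Gaussian average `x ↦ E_B[G(φ+x+w)]`. [folklore] -/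
private theorem measurable_integral_shift {G : EuclideanSpace ℝ (Fin N) → ℝ} (hGm : Measurable G)
    (P : Measure (EuclideanSpace ℝ (Fin N))) [SFinite P] (φ : EuclideanSpace ℝ (Fin N)) :
    Measurable fun x => ∫ w, G (φ + x + w) ∂P := by
  have hsm : StronglyMeasurable
      (Function.uncurry fun (x w : EuclideanSpace ℝ (Fin N)) => G (φ + x + w)) :=
    (hGm.comp ((measurable_const_add φ).comp measurable_fst |>.add measurable_snd)).stronglyMeasurable
  exact (hsm.integral_prod_right (ν := P)).measurable

/-- **The increment of a Gaussian average between two scales**: for `0 ≤ s ≤ s'`,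
`E_{C_{s'}}[G(φ+·)] − E_{C_s}[G(φ+·)] = E_{C_s}[ x ↦ E_{C_{s'}−C_s}[G(φ+x+w) − G(φ+x)] ]`
((e:Gauss-conv) with `C_{s'} = C_s + (C_{s'} − C_s)`). [cite: BauerschmidtBodineauDagallier2023, §3.1 (e:Gauss-conv)] -/
theorem integral_gaussian_C_sub_eq {G : EuclideanSpace ℝ (Fin N) → ℝ} (hGm : Measurable G)
    {K0 : ℝ} (hG : ∀ x, |G x| ≤ K0) {s s' : ℝ} (hs : 0 ≤ s) (hss' : s ≤ s')
    (φ : EuclideanSpace ℝ (Fin N)) :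
    (∫ x, G (φ + x) ∂(multivariateGaussian 0 (D.C s'))) -
        ∫ x, G (φ + x) ∂(multivariateGaussian 0 (D.C s)) =
      ∫ x, (∫ w, (G (φ + x + w) - G (φ + x)) ∂(multivariateGaussian 0 (D.C s' - D.C s)))
        ∂(multivariateGaussian 0 (D.C s)) := by
  have hsplit := integral_gaussian_add_shift (D.posSemidef_C hs) (D.posSemidef_C_sub hs hss') hGm hG φ
  rw [add_sub_cancel] at hsplit
  rw [hsplit, ← integral_sub]
  · refine integral_congr_ae (Eventually.of_forall fun x => ?_)
    simp only
    rw [integral_sub ((integrable_shift_of_bounded hGm hG _ (φ + x))) (integrable_const _),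
      integral_const, probReal_univ, one_smul]
  · refine Integrable.of_bound (measurable_integral_shift hGm _ φ).aestronglyMeasurable K0
      (Eventually.of_forall fun x => ?_)
    have h := norm_integral_le_of_norm_le_const
      (μ := multivariateGaussian 0 (D.C s' - D.C s)) (f := fun w => G (φ + x + w)) (C := K0)
      (Eventually.of_forall fun w => by simpa [Real.norm_eq_abs] using hG (φ + x + w))
    simpa using h
  · exact integrable_shift_of_bounded hGm hG _ φ

/-- Evaluation of an operator-valued map at two fixed vectors is measurable. [folklore] -/
private theorem measurable_eval₂ {D2 : EuclideanSpace ℝ (Fin N) →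
      EuclideanSpace ℝ (Fin N) →L[ℝ] EuclideanSpace ℝ (Fin N) →L[ℝ] ℝ} (hD2m : Measurable D2)
    (v w : EuclideanSpace ℝ (Fin N)) : Measurable fun x => D2 x v w := by
  have hc : Continuous fun L : EuclideanSpace ℝ (Fin N) →L[ℝ] EuclideanSpace ℝ (Fin N) →L[ℝ] ℝ =>
      L v w :=
    (ContinuousLinearMap.apply ℝ ℝ w).continuous.comp
      (ContinuousLinearMap.apply ℝ (EuclideanSpace ℝ (Fin N) →L[ℝ] ℝ) v).continuous
  exact hc.measurable.comp hD2m

/-- `|D²G(x)(v,w)| ≤ ‖D²G(x)‖ ‖v‖ ‖w‖`. [folklore] -/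
private theorem abs_apply₂_le {D2 : EuclideanSpace ℝ (Fin N) →
      EuclideanSpace ℝ (Fin N) →L[ℝ] EuclideanSpace ℝ (Fin N) →L[ℝ] ℝ}
    (x v w : EuclideanSpace ℝ (Fin N)) : |D2 x v w| ≤ ‖D2 x‖ * ‖v‖ * ‖w‖ := by
  rw [← Real.norm_eq_abs]
  calc ‖D2 x v w‖ ≤ ‖D2 x v‖ * ‖w‖ := ContinuousLinearMap.le_opNorm _ _
    _ ≤ ‖D2 x‖ * ‖v‖ * ‖w‖ :=
        mul_le_mul_of_nonneg_right (ContinuousLinearMap.le_opNorm _ _) (norm_nonneg _)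

/-- **Second-order expansion of a Gaussian average between two scales** `0 ≤ s ≤ s'`:
`|E_{C_{s'}}[G(φ+·)] − E_{C_s}[G(φ+·)] − ½ Σ_{ij} (C_{s'}−C_s)_{ij} E_{C_s}[∂_i∂_jG(φ+·)]|
 ≤ ε tr(C_{s'}−C_s) + 2Mδ⁻² (Σ_{ij}|(C_{s'}−C_s)_{ij}|)² E[‖z‖⁴]` for `G` bounded with bounded,
`(ε,δ)`-uniformly continuous Hessian (the two-scale form of [BBD] Prop 5's heat equation).
[cite: BauerschmidtBodineauDagallier2023, Proposition 5 (proof)] -/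
theorem abs_integral_C_sub_integral_C_sub_sum_le {G : EuclideanSpace ℝ (Fin N) → ℝ}
    {D1 : EuclideanSpace ℝ (Fin N) → EuclideanSpace ℝ (Fin N) →L[ℝ] ℝ}
    {D2 : EuclideanSpace ℝ (Fin N) → EuclideanSpace ℝ (Fin N) →L[ℝ] EuclideanSpace ℝ (Fin N) →L[ℝ] ℝ}
    (h1 : ∀ x, HasFDerivAt G (D1 x) x) (h2 : ∀ x, HasFDerivAt D1 (D2 x) x) (hD2m : Measurable D2)
    {K0 : ℝ} (hG : ∀ x, |G x| ≤ K0) {M : ℝ} (hM : ∀ x, ‖D2 x‖ ≤ M) {ε δ : ℝ} (hδ : 0 < δ)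
    (hUC : ∀ x y, ‖x - y‖ < δ → ‖D2 x - D2 y‖ ≤ ε) {s s' : ℝ} (hs : 0 ≤ s) (hss' : s ≤ s')
    (φ : EuclideanSpace ℝ (Fin N)) :
    |(∫ x, G (φ + x) ∂(multivariateGaussian 0 (D.C s'))) -
        (∫ x, G (φ + x) ∂(multivariateGaussian 0 (D.C s))) -
        (1 / 2) * ∑ i, ∑ j, (D.C s' - D.C s) i j *
          ∫ x, D2 (φ + x) (EuclideanSpace.single i 1) (EuclideanSpace.single j 1)
            ∂(multivariateGaussian 0 (D.C s))| ≤
      ε * ∑ i, (D.C s' - D.C s) i i + 2 * M / δ ^ 2 * ((∑ i, ∑ j, |(D.C s' - D.C s) i j|) ^ 2 *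
        ∫ z, ‖z‖ ^ 4 ∂(stdGaussian (EuclideanSpace ℝ (Fin N)))) := by
  set S := D.C s' - D.C s with hSdef
  set P := multivariateGaussian 0 (D.C s) with hP
  have hS : S.PosSemidef := D.posSemidef_C_sub hs hss'
  have hGc : Continuous G := continuous_iff_continuousAt.2 fun x => (h1 x).continuousAt
  have hGm : Measurable G := hGc.measurable
  have hM0 : 0 ≤ M := le_trans (norm_nonneg (D2 φ)) (hM φ)
  rw [integral_gaussian_C_sub_eq D hGm hG hs hss' φ]
  -- the quadratic term as an integral over `P`
  set e : Fin N → EuclideanSpace ℝ (Fin N) := fun i => EuclideanSpace.single i 1 with he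
  have hQint : ∀ i j, Integrable (fun x => D2 (φ + x) (e i) (e j)) P := by
    intro i j
    refine Integrable.of_bound ((measurable_eval₂ hD2m (e i) (e j)).comp
      (measurable_const_add φ)).aestronglyMeasurable M (Eventually.of_forall fun x => ?_)
    rw [Real.norm_eq_abs]
    calc |D2 (φ + x) (e i) (e j)| ≤ ‖D2 (φ + x)‖ * ‖e i‖ * ‖e j‖ := abs_apply₂_le _ _ _
      _ = ‖D2 (φ + x)‖ := by simp [he]
      _ ≤ M := hM _
  have hsum : (1 / 2) * ∑ i, ∑ j, S i j * ∫ x, D2 (φ + x) (e i) (e j) ∂P =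
      ∫ x, (1 / 2) * ∑ i, ∑ j, S i j * D2 (φ + x) (e i) (e j) ∂P := by
    rw [integral_const_mul]
    congr 1
    rw [integral_finsetSum _ fun i _ => integrable_finsetSum _ fun j _ => (hQint i j).const_mul _]
    refine Finset.sum_congr rfl fun i _ => ?_
    rw [integral_finsetSum _ fun j _ => (hQint i j).const_mul _]
    refine Finset.sum_congr rfl fun j _ => ?_
    rw [integral_const_mul]
  have hQ : Integrable (fun x => (1 / 2) * ∑ i, ∑ j, S i j * D2 (φ + x) (e i) (e j)) P :=
    (integrable_finsetSum _ fun i _ => integrable_finsetSum _ fun j _ =>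
      (hQint i j).const_mul _).const_mul _
  have hJ : Integrable (fun x => ∫ w, (G (φ + x + w) - G (φ + x))
      ∂(multivariateGaussian 0 S)) P := by
    have hJ' : (fun x => ∫ w, (G (φ + x + w) - G (φ + x)) ∂(multivariateGaussian 0 S)) =
        fun x => (∫ w, G (φ + x + w) ∂(multivariateGaussian 0 S)) - G (φ + x) := by
      funext x
      rw [integral_sub (integrable_shift_of_bounded hGm hG _ (φ + x)) (integrable_const _),
        integral_const, probReal_univ, one_smul]
    rw [hJ']
    refine Integrable.sub ?_ (integrable_shift_of_bounded hGm hG _ φ)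
    refine Integrable.of_bound (measurable_integral_shift hGm _ φ).aestronglyMeasurable K0
      (Eventually.of_forall fun x => ?_)
    have h := norm_integral_le_of_norm_le_const
      (μ := multivariateGaussian 0 S) (f := fun w => G (φ + x + w)) (C := K0)
      (Eventually.of_forall fun w => by simpa [Real.norm_eq_abs] using hG (φ + x + w))
    simpa using h
  rw [hsum, ← integral_sub hJ hQ]
  have hpt : ∀ x, |(∫ w, (G (φ + x + w) - G (φ + x)) ∂(multivariateGaussian 0 S)) -
      (1 / 2) * ∑ i, ∑ j, S i j * D2 (φ + x) (e i) (e j)| ≤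
      ε * ∑ i, S i i + 2 * M / δ ^ 2 * ((∑ i, ∑ j, |S i j|) ^ 2 *
        ∫ z, ‖z‖ ^ 4 ∂(stdGaussian (EuclideanSpace ℝ (Fin N)))) :=
    fun x => abs_integral_sub_sub_half_sum_le h1 h2 hG hM hδ hUC hS (φ + x)
  have h := norm_integral_le_of_norm_le_const (μ := P)
    (f := fun x => (∫ w, (G (φ + x + w) - G (φ + x)) ∂(multivariateGaussian 0 S)) -
      (1 / 2) * ∑ i, ∑ j, S i j * D2 (φ + x) (e i) (e j))
    (C := ε * ∑ i, S i i + 2 * M / δ ^ 2 * ((∑ i, ∑ j, |S i j|) ^ 2 *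
        ∫ z, ‖z‖ ^ 4 ∂(stdGaussian (EuclideanSpace ℝ (Fin N)))))
    (Eventually.of_forall fun x => by rw [Real.norm_eq_abs]; exact hpt x)
  rw [Real.norm_eq_abs, probReal_univ, mul_one] at h
  exact h

/-- From metric uniform continuity: an `(ε,δ)` pair in the `‖·‖ ≤ ε` form. [folklore] -/
private theorem exists_delta_of_uniformContinuous {X Y : Type*} [NormedAddCommGroup X]
    [NormedAddCommGroup Y] {f : X → Y} (hf : UniformContinuous f) {ε : ℝ} (hε : 0 < ε) :
    ∃ δ > 0, ∀ x y, ‖x - y‖ < δ → ‖f x - f y‖ ≤ ε := by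
  obtain ⟨δ, hδ, h⟩ := Metric.uniformContinuous_iff.mp hf ε hε
  refine ⟨δ, hδ, fun x y hxy => ?_⟩
  have h' := h (a := x) (b := y) (by rwa [dist_eq_norm])
  rw [dist_eq_norm] at h'
  exact h'.le

/-- **[BBD] Proposition 5 — the heat equation, right derivative.**  Let `C_t` be a covariance
decomposition (`Polchinski.CovDecomposition`, possibly DEGENERATE positive semidefinite `Ċ_t`), and
`G : ℝ^N → ℝ` bounded with first and second Fréchet derivatives `D1`, `D2` everywhere, `D2` bounded and
uniformly continuous.  Then for every `t ≥ 0` and `φ`, the Gaussian average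
`F_s(φ) = E_{C_s}[G(φ + ζ)]` has the RIGHT derivative at `s = t`
`d/ds F_s(φ) = ½ Σ_{ij} Ċ_t^{ij} E_{C_t}[∂_i∂_j G(φ + ζ)]` (`= ½ E_{C_t}[(Δ_{Ċ_t}G)(φ+ζ)]`, [BBD]
(e:DeltaC)); at `t = 0` only the right derivative is meaningful.
[cite: BauerschmidtBodineauDagallier2023, Proposition 5] -/
theorem hasDerivWithinAt_integral_gaussian_Ici {G : EuclideanSpace ℝ (Fin N) → ℝ}
    {D1 : EuclideanSpace ℝ (Fin N) → EuclideanSpace ℝ (Fin N) →L[ℝ] ℝ}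
    {D2 : EuclideanSpace ℝ (Fin N) → EuclideanSpace ℝ (Fin N) →L[ℝ] EuclideanSpace ℝ (Fin N) →L[ℝ] ℝ}
    (h1 : ∀ x, HasFDerivAt G (D1 x) x) (h2 : ∀ x, HasFDerivAt D1 (D2 x) x)
    {K0 : ℝ} (hG : ∀ x, |G x| ≤ K0) {M : ℝ} (hM : ∀ x, ‖D2 x‖ ≤ M) (hUC : UniformContinuous D2)
    {t : ℝ} (ht : 0 ≤ t) (φ : EuclideanSpace ℝ (Fin N)) :
    HasDerivWithinAt (fun s => ∫ x, G (φ + x) ∂(multivariateGaussian 0 (D.C s)))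
      ((1 / 2) * ∑ i, ∑ j, D.Cdot t i j *
        ∫ x, D2 (φ + x) (EuclideanSpace.single i 1) (EuclideanSpace.single j 1)
          ∂(multivariateGaussian 0 (D.C t))) (Ici t) t := by
  have hD2m : Measurable D2 := hUC.continuous.measurable
  rw [← hasDerivWithinAt_Ioi_iff_Ici,
    hasDerivWithinAt_iff_tendsto_slope' (show t ∉ Ioi t from fun h => lt_irrefl t h)]
  set e : Fin N → EuclideanSpace ℝ (Fin N) := fun i => EuclideanSpace.single i 1 with he
  set u : ℝ → ℝ := fun s => ∫ x, G (φ + x) ∂(multivariateGaussian 0 (D.C s)) with hu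
  set I : Fin N → Fin N → ℝ := fun i j =>
    ∫ x, D2 (φ + x) (e i) (e j) ∂(multivariateGaussian 0 (D.C t)) with hI
  set L : ℝ := (1 / 2) * ∑ i, ∑ j, D.Cdot t i j * I i j with hL
  set σ : ℝ → Fin N → Fin N → ℝ := fun r i j => (D.C r i j - D.C t i j) / (r - t) with hσ
  set K4 : ℝ := ∫ z, ‖z‖ ^ 4 ∂(stdGaussian (EuclideanSpace ℝ (Fin N))) with hK4
  -- limits of the covariance slopes
  have hσt : ∀ i j, Tendsto (fun r => σ r i j) (𝓝[>] t) (𝓝 (D.Cdot t i j)) := by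
    intro i j
    have h := (D.hasDerivAt_C t ht i j).tendsto_slope
    have h' := h.mono_left (nhdsWithin_mono t (fun r (hr : t < r) =>
      Set.mem_compl_singleton_iff.2 hr.ne'))
    have hfun : (fun r => σ r i j) = slope (fun s => D.C s i j) t := by
      funext r; simp only [hσ, slope_def_field]
    rw [hfun]
    exact h'
  have hA : Tendsto (fun r => (1 / 2) * ∑ i, ∑ j, σ r i j * I i j) (𝓝[>] t) (𝓝 L) :=
    (tendsto_finsetSum _ fun i _ => tendsto_finsetSum _ fun j _ =>
      (hσt i j).mul_const _).const_mul _
  have hdiag : Tendsto (fun r => ∑ i, σ r i i) (𝓝[>] t) (𝓝 (∑ i, D.Cdot t i i)) :=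
    tendsto_finsetSum _ fun i _ => hσt i i
  have hσabs : Tendsto (fun r => ∑ i, ∑ j, |σ r i j|) (𝓝[>] t) (𝓝 (∑ i, ∑ j, |D.Cdot t i j|)) :=
    tendsto_finsetSum _ fun i _ => tendsto_finsetSum _ fun j _ => (hσt i j).abs
  have hSabs : Tendsto (fun r => ∑ i, ∑ j, |D.C r i j - D.C t i j|) (𝓝[>] t) (𝓝 0) := by
    have h0 : ∀ i j, Tendsto (fun r => |D.C r i j - D.C t i j|) (𝓝[>] t) (𝓝 0) := by
      intro i j
      have h := ((D.hasDerivAt_C t ht i j).continuousAt.tendsto.sub_const (D.C t i j)).abs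
      rw [sub_self, abs_zero] at h
      exact h.mono_left nhdsWithin_le_nhds
    have h := tendsto_finsetSum (Finset.univ : Finset (Fin N)) fun i _ =>
      tendsto_finsetSum (Finset.univ : Finset (Fin N)) fun j _ => h0 i j
    simpa using h
  -- the ε-argument
  rw [Metric.tendsto_nhds]
  intro ε₀ hε₀
  set T : ℝ := ∑ i, |D.Cdot t i i| + 1 with hT
  have hT0 : 0 < T := by positivity
  have hTlt : ∑ i, D.Cdot t i i < T := by
    have : ∑ i, D.Cdot t i i ≤ ∑ i, |D.Cdot t i i| := Finset.sum_le_sum fun i _ => le_abs_self _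
    linarith
  set ε₁ : ℝ := ε₀ / (4 * T) with hε₁
  have hε₁0 : 0 < ε₁ := by positivity
  obtain ⟨δ, hδ, hUCδ⟩ := exists_delta_of_uniformContinuous (X := EuclideanSpace ℝ (Fin N))
    (Y := EuclideanSpace ℝ (Fin N) →L[ℝ] EuclideanSpace ℝ (Fin N) →L[ℝ] ℝ) hUC hε₁0
  have hM0 : 0 ≤ M := le_trans (norm_nonneg (D2 φ)) (hM φ)
  have hK40 : 0 ≤ K4 := integral_nonneg fun z => by positivity
  have ev1 : ∀ᶠ r in 𝓝[>] t, dist ((1 / 2) * ∑ i, ∑ j, σ r i j * I i j) L < ε₀ / 4 :=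
    Metric.tendsto_nhds.mp hA _ (by positivity)
  have ev2 : ∀ᶠ r in 𝓝[>] t, ∑ i, σ r i i < T := (tendsto_order.1 hdiag).2 T hTlt
  have ev3 : ∀ᶠ r in 𝓝[>] t,
      2 * M / δ ^ 2 * K4 * ((∑ i, ∑ j, |D.C r i j - D.C t i j|) * ∑ i, ∑ j, |σ r i j|) < ε₀ / 4 := by
    have h := (hSabs.mul hσabs).const_mul (2 * M / δ ^ 2 * K4)
    rw [zero_mul, mul_zero] at h
    exact (tendsto_order.1 h).2 _ (by positivity)
  have ev4 : ∀ᶠ r in 𝓝[>] t, t < r := self_mem_nhdsWithin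
  filter_upwards [ev1, ev2, ev3, ev4] with r hr1 hr2 hr3 hr4
  have hh : 0 < r - t := sub_pos.2 hr4
  -- the two-scale expansion at base `t`
  have hE := abs_integral_C_sub_integral_C_sub_sum_le D h1 h2 hD2m hG hM hδ hUCδ ht hr4.le φ
  -- entries of `C_r − C_t` in terms of the slopes
  have hSσ : ∀ i j, (D.C r - D.C t) i j = (r - t) * σ r i j := by
    intro i j
    simp only [Matrix.sub_apply, hσ]
    rw [mul_div_cancel₀ _ hh.ne']
  have ha : ∑ i, (D.C r - D.C t) i i = (r - t) * ∑ i, σ r i i := by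
    rw [Finset.mul_sum]; exact Finset.sum_congr rfl fun i _ => hSσ i i
  have hb : ∑ i, ∑ j, |(D.C r - D.C t) i j| = (r - t) * ∑ i, ∑ j, |σ r i j| := by
    rw [Finset.mul_sum]
    refine Finset.sum_congr rfl fun i _ => ?_
    rw [Finset.mul_sum]
    refine Finset.sum_congr rfl fun j _ => ?_
    rw [hSσ, abs_mul, abs_of_pos hh]
  have hb' : ∑ i, ∑ j, |(D.C r - D.C t) i j| = ∑ i, ∑ j, |D.C r i j - D.C t i j| := by
    simp only [Matrix.sub_apply]
  have hquad : (1 / 2) * ∑ i, ∑ j, (D.C r - D.C t) i j * I i j =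
      (r - t) * ((1 / 2) * ∑ i, ∑ j, σ r i j * I i j) := by
    simp_rw [hSσ]
    rw [Finset.mul_sum, Finset.mul_sum, Finset.mul_sum]
    refine Finset.sum_congr rfl fun i _ => ?_
    rw [Finset.mul_sum, Finset.mul_sum, Finset.mul_sum]
    refine Finset.sum_congr rfl fun j _ => ?_
    ring
  -- assemble
  rw [slope_def_field, Real.dist_eq]
  set Δ := u r - u t - (1 / 2) * ∑ i, ∑ j, (D.C r - D.C t) i j * I i j with hΔ
  set A := (1 / 2) * ∑ i, ∑ j, σ r i j * I i j with hAdef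
  have hq : (u r - u t) / (r - t) - L = Δ / (r - t) + (A - L) := by
    rw [hΔ, hquad]
    field_simp
    ring
  have hΔle : |Δ| / (r - t) ≤ ε₁ * ∑ i, σ r i i +
      2 * M / δ ^ 2 * K4 * ((∑ i, ∑ j, |D.C r i j - D.C t i j|) * ∑ i, ∑ j, |σ r i j|) := by
    rw [div_le_iff₀ hh]
    have hE' : |Δ| ≤ ε₁ * ((r - t) * ∑ i, σ r i i) +
        2 * M / δ ^ 2 * (((r - t) * ∑ i, ∑ j, |σ r i j|) *
          (∑ i, ∑ j, |D.C r i j - D.C t i j|) * K4) := by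
      have h := hE
      rw [ha] at h
      calc |Δ| ≤ ε₁ * ((r - t) * ∑ i, σ r i i) +
            2 * M / δ ^ 2 * ((∑ i, ∑ j, |(D.C r - D.C t) i j|) ^ 2 * K4) := h
        _ = _ := by rw [pow_two, hb, ← hb, hb']; ring_nf
    calc |Δ| ≤ _ := hE'
      _ = _ := by ring
  have hA' : |A - L| < ε₀ / 4 := by rwa [Real.dist_eq] at hr1
  calc |(u r - u t) / (r - t) - L| = |Δ / (r - t) + (A - L)| := by rw [hq]
    _ ≤ |Δ / (r - t)| + |A - L| := abs_add_le _ _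
    _ = |Δ| / (r - t) + |A - L| := by rw [abs_div, abs_of_pos hh]
    _ ≤ ε₁ * ∑ i, σ r i i +
        2 * M / δ ^ 2 * K4 * ((∑ i, ∑ j, |D.C r i j - D.C t i j|) * ∑ i, ∑ j, |σ r i j|) +
        |A - L| := by gcongr
    _ < ε₁ * T + ε₀ / 4 + ε₀ / 4 := by gcongr
    _ = ε₀ / 4 + ε₀ / 4 + ε₀ / 4 := by rw [hε₁]; field_simp
    _ < ε₀ := by linarith

/-- `∫ (H(y+w) − H(y)) dP = (∫ H(y+w) dP) − H(y)` for a probability measure. [folklore] -/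
private theorem integral_shift_sub_self {H : EuclideanSpace ℝ (Fin N) → ℝ} (hHm : Measurable H)
    {MH : ℝ} (hH : ∀ x, |H x| ≤ MH) (P : Measure (EuclideanSpace ℝ (Fin N))) [IsProbabilityMeasure P]
    (y : EuclideanSpace ℝ (Fin N)) :
    ∫ w, (H (y + w) - H y) ∂P = (∫ w, H (y + w) ∂P) - H y := by
  rw [integral_sub (integrable_shift_of_bounded hHm hH P y) (integrable_const _), integral_const,
    probReal_univ, one_smul]

/-- **Weak continuity of `t ↦ E_{C_t}[H(φ+ζ)]` on `[0, ∞)`** for `H` bounded, measurable and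
uniformly continuous (quantitatively: `|E_{C_r}H − E_{C_t}H| ≤ ε + 2M_H δ⁻² |tr(C_r − C_t)|`),
the continuity in the scale parameter used throughout [BBD] §3.2–3.3 (e.g. `P_{t,t} = id` as a
limit, Prop 8). [cite: BauerschmidtBodineauDagallier2023, Proposition 8 (proof)] -/
theorem tendsto_integral_gaussian_Ici {H : EuclideanSpace ℝ (Fin N) → ℝ} (hHm : Measurable H)
    {MH : ℝ} (hH : ∀ x, |H x| ≤ MH) (hUC : UniformContinuous H) {t : ℝ} (ht : 0 ≤ t)
    (φ : EuclideanSpace ℝ (Fin N)) :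
    Tendsto (fun r => ∫ x, H (φ + x) ∂(multivariateGaussian 0 (D.C r))) (𝓝[Ici 0] t)
      (𝓝 (∫ x, H (φ + x) ∂(multivariateGaussian 0 (D.C t)))) := by
  have hMH0 : 0 ≤ MH := le_trans (abs_nonneg _) (hH φ)
  rw [Metric.tendsto_nhds]
  intro ε₀ hε₀
  obtain ⟨δ, hδ, hUCδ⟩ := exists_delta_of_uniformContinuous (X := EuclideanSpace ℝ (Fin N))
    (Y := ℝ) hUC (half_pos hε₀)
  have hUCδ' : ∀ x y, ‖x - y‖ < δ → |H x - H y| ≤ ε₀ / 2 := fun x y hxy => by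
    rw [← Real.norm_eq_abs]; exact hUCδ x y hxy
  -- the two-sided quantitative bound for `r ≥ 0`
  have key : ∀ r, 0 ≤ r →
      |(∫ x, H (φ + x) ∂(multivariateGaussian 0 (D.C r))) -
          ∫ x, H (φ + x) ∂(multivariateGaussian 0 (D.C t))| ≤
        ε₀ / 2 + 2 * MH / δ ^ 2 * |∑ i, (D.C r i i - D.C t i i)| := by
    intro r hr
    rcases le_total t r with htr | hrt
    · -- `t ≤ r`: expand around `C_t`
      rw [integral_gaussian_C_sub_eq D hHm hH ht htr φ]
      have hpt : ∀ x, |∫ w, (H (φ + x + w) - H (φ + x))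
          ∂(multivariateGaussian 0 (D.C r - D.C t))| ≤
          ε₀ / 2 + 2 * MH / δ ^ 2 * ∑ i, (D.C r - D.C t) i i := by
        intro x
        rw [integral_shift_sub_self hHm hH]
        exact abs_integral_shift_sub_le hHm hH hδ hUCδ' (D.posSemidef_C_sub ht htr) (φ + x)
      have h := norm_integral_le_of_norm_le_const (μ := multivariateGaussian 0 (D.C t))
        (f := fun x => ∫ w, (H (φ + x + w) - H (φ + x)) ∂(multivariateGaussian 0 (D.C r - D.C t)))
        (C := ε₀ / 2 + 2 * MH / δ ^ 2 * ∑ i, (D.C r - D.C t) i i)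
        (Eventually.of_forall fun x => by rw [Real.norm_eq_abs]; exact hpt x)
      rw [Real.norm_eq_abs, probReal_univ, mul_one] at h
      refine h.trans ?_
      have e : ∑ i, (D.C r - D.C t) i i = ∑ i, (D.C r i i - D.C t i i) :=
        Finset.sum_congr rfl fun i _ => by simp [Matrix.sub_apply]
      rw [e]
      gcongr
      exact le_abs_self _
    · -- `r ≤ t`: expand around `C_r`
      rw [abs_sub_comm, integral_gaussian_C_sub_eq D hHm hH hr hrt φ]
      have hpt : ∀ x, |∫ w, (H (φ + x + w) - H (φ + x))
          ∂(multivariateGaussian 0 (D.C t - D.C r))| ≤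
          ε₀ / 2 + 2 * MH / δ ^ 2 * ∑ i, (D.C t - D.C r) i i := by
        intro x
        rw [integral_shift_sub_self hHm hH]
        exact abs_integral_shift_sub_le hHm hH hδ hUCδ' (D.posSemidef_C_sub hr hrt) (φ + x)
      have h := norm_integral_le_of_norm_le_const (μ := multivariateGaussian 0 (D.C r))
        (f := fun x => ∫ w, (H (φ + x + w) - H (φ + x)) ∂(multivariateGaussian 0 (D.C t - D.C r)))
        (C := ε₀ / 2 + 2 * MH / δ ^ 2 * ∑ i, (D.C t - D.C r) i i)
        (Eventually.of_forall fun x => by rw [Real.norm_eq_abs]; exact hpt x)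
      rw [Real.norm_eq_abs, probReal_univ, mul_one] at h
      refine h.trans ?_
      have e : ∑ i, (D.C t - D.C r) i i = -∑ i, (D.C r i i - D.C t i i) := by
        rw [← Finset.sum_neg_distrib]
        exact Finset.sum_congr rfl fun i _ => by simp [Matrix.sub_apply]
      rw [e]
      gcongr
      exact neg_le_abs _
  -- the trace of `C_r − C_t` tends to `0`
  have htr : Tendsto (fun r => 2 * MH / δ ^ 2 * |∑ i, (D.C r i i - D.C t i i)|) (𝓝[Ici 0] t)
      (𝓝 0) := by
    have h0 : ∀ i, Tendsto (fun r => D.C r i i - D.C t i i) (𝓝[Ici 0] t) (𝓝 0) := by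
      intro i
      have h := (D.hasDerivAt_C t ht i i).continuousAt.tendsto.sub_const (D.C t i i)
      rw [sub_self] at h
      exact h.mono_left nhdsWithin_le_nhds
    have h := ((tendsto_finsetSum (Finset.univ : Finset (Fin N)) fun i _ => h0 i).abs).const_mul
      (2 * MH / δ ^ 2)
    simpa using h
  have ev1 : ∀ᶠ r in 𝓝[Ici 0] t, 2 * MH / δ ^ 2 * |∑ i, (D.C r i i - D.C t i i)| < ε₀ / 2 :=
    (tendsto_order.1 htr).2 _ (half_pos hε₀)
  have ev2 : ∀ᶠ r in 𝓝[Ici 0] t, r ∈ Ici (0:ℝ) := self_mem_nhdsWithin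
  filter_upwards [ev1, ev2] with r hr1 hr2
  rw [Real.dist_eq]
  calc |(∫ x, H (φ + x) ∂(multivariateGaussian 0 (D.C r))) -
        ∫ x, H (φ + x) ∂(multivariateGaussian 0 (D.C t))|
      ≤ ε₀ / 2 + 2 * MH / δ ^ 2 * |∑ i, (D.C r i i - D.C t i i)| := key r hr2
    _ < ε₀ / 2 + ε₀ / 2 := by gcongr
    _ = ε₀ := by ring

/-- The matrix elements `x ↦ D²G(x)(e_i, e_j)` of a bounded uniformly continuous Hessian are
bounded, measurable and uniformly continuous. [folklore] -/
private theorem eval₂_props {D2 : EuclideanSpace ℝ (Fin N) →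
      EuclideanSpace ℝ (Fin N) →L[ℝ] EuclideanSpace ℝ (Fin N) →L[ℝ] ℝ}
    {M : ℝ} (hM : ∀ x, ‖D2 x‖ ≤ M) (hUC : UniformContinuous D2) (i j : Fin N) :
    Measurable (fun x => D2 x (EuclideanSpace.single i 1) (EuclideanSpace.single j 1)) ∧
    (∀ x, |D2 x (EuclideanSpace.single i 1) (EuclideanSpace.single j 1)| ≤ M) ∧
    UniformContinuous (fun x => D2 x (EuclideanSpace.single i 1) (EuclideanSpace.single j 1)) := by
  have hev : UniformContinuous fun L : EuclideanSpace ℝ (Fin N) →L[ℝ] EuclideanSpace ℝ (Fin N) →L[ℝ] ℝ =>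
      L (EuclideanSpace.single i 1) (EuclideanSpace.single j 1) :=
    (ContinuousLinearMap.apply ℝ ℝ (EuclideanSpace.single j (1:ℝ))).uniformContinuous.comp
      (ContinuousLinearMap.apply ℝ (EuclideanSpace ℝ (Fin N) →L[ℝ] ℝ)
        (EuclideanSpace.single i (1:ℝ))).uniformContinuous
  refine ⟨measurable_eval₂ hUC.continuous.measurable _ _, fun x => ?_, hev.comp hUC⟩
  calc |D2 x (EuclideanSpace.single i 1) (EuclideanSpace.single j 1)|
      ≤ ‖D2 x‖ * ‖EuclideanSpace.single i (1:ℝ)‖ * ‖EuclideanSpace.single j (1:ℝ)‖ :=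
        abs_apply₂_le _ _ _
    _ = ‖D2 x‖ := by simp
    _ ≤ M := hM x

/-- **[BBD] Proposition 5 — the heat equation, left derivative** at `t > 0` (same setting as
`hasDerivWithinAt_integral_gaussian_Ici`; the expansion is now based at the moving scale `r ↑ t`,
and the continuity of `r ↦ E_{C_r}[∂_i∂_jG(φ+ζ)]` closes the argument).
[cite: BauerschmidtBodineauDagallier2023, Proposition 5] -/
theorem hasDerivWithinAt_integral_gaussian_Iic {G : EuclideanSpace ℝ (Fin N) → ℝ}
    {D1 : EuclideanSpace ℝ (Fin N) → EuclideanSpace ℝ (Fin N) →L[ℝ] ℝ}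
    {D2 : EuclideanSpace ℝ (Fin N) → EuclideanSpace ℝ (Fin N) →L[ℝ] EuclideanSpace ℝ (Fin N) →L[ℝ] ℝ}
    (h1 : ∀ x, HasFDerivAt G (D1 x) x) (h2 : ∀ x, HasFDerivAt D1 (D2 x) x)
    {K0 : ℝ} (hG : ∀ x, |G x| ≤ K0) {M : ℝ} (hM : ∀ x, ‖D2 x‖ ≤ M) (hUC : UniformContinuous D2)
    {t : ℝ} (ht : 0 < t) (φ : EuclideanSpace ℝ (Fin N)) :
    HasDerivWithinAt (fun s => ∫ x, G (φ + x) ∂(multivariateGaussian 0 (D.C s)))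
      ((1 / 2) * ∑ i, ∑ j, D.Cdot t i j *
        ∫ x, D2 (φ + x) (EuclideanSpace.single i 1) (EuclideanSpace.single j 1)
          ∂(multivariateGaussian 0 (D.C t))) (Iic t) t := by
  have hD2m : Measurable D2 := hUC.continuous.measurable
  rw [← hasDerivWithinAt_Iio_iff_Iic,
    hasDerivWithinAt_iff_tendsto_slope' (show t ∉ Iio t from fun h => lt_irrefl t h)]
  set e : Fin N → EuclideanSpace ℝ (Fin N) := fun i => EuclideanSpace.single i 1 with he
  set u : ℝ → ℝ := fun s => ∫ x, G (φ + x) ∂(multivariateGaussian 0 (D.C s)) with hu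
  set Ir : ℝ → Fin N → Fin N → ℝ := fun r i j =>
    ∫ x, D2 (φ + x) (e i) (e j) ∂(multivariateGaussian 0 (D.C r)) with hIr
  set L : ℝ := (1 / 2) * ∑ i, ∑ j, D.Cdot t i j * Ir t i j with hL
  set σ : ℝ → Fin N → Fin N → ℝ := fun r i j => (D.C r i j - D.C t i j) / (r - t) with hσ
  set K4 : ℝ := ∫ z, ‖z‖ ^ 4 ∂(stdGaussian (EuclideanSpace ℝ (Fin N))) with hK4
  have hF : 𝓝[<] t ≤ 𝓝[Ici 0] t := by
    rw [← nhdsWithin_Ioo_eq_nhdsLT ht]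
    exact nhdsWithin_mono _ fun r hr => hr.1.le
  -- limits of the covariance slopes and of the moving Hessian averages
  have hσt : ∀ i j, Tendsto (fun r => σ r i j) (𝓝[<] t) (𝓝 (D.Cdot t i j)) := by
    intro i j
    have h := (D.hasDerivAt_C t ht.le i j).tendsto_slope
    have h' := h.mono_left (nhdsWithin_mono t (fun r (hr : r < t) =>
      Set.mem_compl_singleton_iff.2 hr.ne))
    have hfun : (fun r => σ r i j) = slope (fun s => D.C s i j) t := by
      funext r; simp only [hσ, slope_def_field]
    rw [hfun]
    exact h'
  have hIt : ∀ i j, Tendsto (fun r => Ir r i j) (𝓝[<] t) (𝓝 (Ir t i j)) := by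
    intro i j
    obtain ⟨hm, hb, huc⟩ := eval₂_props hM hUC i j
    exact (tendsto_integral_gaussian_Ici D hm hb huc ht.le φ).mono_left hF
  have hA : Tendsto (fun r => (1 / 2) * ∑ i, ∑ j, σ r i j * Ir r i j) (𝓝[<] t) (𝓝 L) :=
    (tendsto_finsetSum _ fun i _ => tendsto_finsetSum _ fun j _ =>
      (hσt i j).mul (hIt i j)).const_mul _
  have hdiag : Tendsto (fun r => ∑ i, σ r i i) (𝓝[<] t) (𝓝 (∑ i, D.Cdot t i i)) :=
    tendsto_finsetSum _ fun i _ => hσt i i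
  have hσabs : Tendsto (fun r => ∑ i, ∑ j, |σ r i j|) (𝓝[<] t) (𝓝 (∑ i, ∑ j, |D.Cdot t i j|)) :=
    tendsto_finsetSum _ fun i _ => tendsto_finsetSum _ fun j _ => (hσt i j).abs
  have hSabs : Tendsto (fun r => ∑ i, ∑ j, |D.C t i j - D.C r i j|) (𝓝[<] t) (𝓝 0) := by
    have h0 : ∀ i j, Tendsto (fun r => |D.C t i j - D.C r i j|) (𝓝[<] t) (𝓝 0) := by
      intro i j
      have h := ((D.hasDerivAt_C t ht.le i j).continuousAt.tendsto.const_sub (D.C t i j)).abs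
      rw [sub_self, abs_zero] at h
      exact h.mono_left nhdsWithin_le_nhds
    have h := tendsto_finsetSum (Finset.univ : Finset (Fin N)) fun i _ =>
      tendsto_finsetSum (Finset.univ : Finset (Fin N)) fun j _ => h0 i j
    simpa using h
  -- the ε-argument
  rw [Metric.tendsto_nhds]
  intro ε₀ hε₀
  set T : ℝ := ∑ i, |D.Cdot t i i| + 1 with hT
  have hT0 : 0 < T := by positivity
  have hTlt : ∑ i, D.Cdot t i i < T := by
    have : ∑ i, D.Cdot t i i ≤ ∑ i, |D.Cdot t i i| := Finset.sum_le_sum fun i _ => le_abs_self _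
    linarith
  set ε₁ : ℝ := ε₀ / (4 * T) with hε₁
  have hε₁0 : 0 < ε₁ := by positivity
  obtain ⟨δ, hδ, hUCδ⟩ := exists_delta_of_uniformContinuous (X := EuclideanSpace ℝ (Fin N))
    (Y := EuclideanSpace ℝ (Fin N) →L[ℝ] EuclideanSpace ℝ (Fin N) →L[ℝ] ℝ) hUC hε₁0
  have hM0 : 0 ≤ M := le_trans (norm_nonneg (D2 φ)) (hM φ)
  have hK40 : 0 ≤ K4 := integral_nonneg fun z => by positivity
  have ev1 : ∀ᶠ r in 𝓝[<] t, dist ((1 / 2) * ∑ i, ∑ j, σ r i j * Ir r i j) L < ε₀ / 4 :=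
    Metric.tendsto_nhds.mp hA _ (by positivity)
  have ev2 : ∀ᶠ r in 𝓝[<] t, ∑ i, σ r i i < T := (tendsto_order.1 hdiag).2 T hTlt
  have ev3 : ∀ᶠ r in 𝓝[<] t,
      2 * M / δ ^ 2 * K4 * ((∑ i, ∑ j, |D.C t i j - D.C r i j|) * ∑ i, ∑ j, |σ r i j|) < ε₀ / 4 := by
    have h := (hSabs.mul hσabs).const_mul (2 * M / δ ^ 2 * K4)
    rw [zero_mul, mul_zero] at h
    exact (tendsto_order.1 h).2 _ (by positivity)
  have ev4 : ∀ᶠ r in 𝓝[<] t, r ∈ Ioo 0 t := Ioo_mem_nhdsLT ht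
  filter_upwards [ev1, ev2, ev3, ev4] with r hr1 hr2 hr3 hr4
  have hr0 : 0 ≤ r := hr4.1.le
  have hrt : r < t := hr4.2
  have hh : 0 < t - r := sub_pos.2 hrt
  -- the two-scale expansion at base `r`
  have hE := abs_integral_C_sub_integral_C_sub_sum_le D h1 h2 hD2m hG hM hδ hUCδ hr0 hrt.le φ
  have hSσ : ∀ i j, (D.C t - D.C r) i j = (t - r) * σ r i j := by
    intro i j
    simp only [Matrix.sub_apply, hσ]
    have hne : r - t ≠ 0 := sub_ne_zero.2 hrt.ne
    field_simp
    ring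
  have ha : ∑ i, (D.C t - D.C r) i i = (t - r) * ∑ i, σ r i i := by
    rw [Finset.mul_sum]; exact Finset.sum_congr rfl fun i _ => hSσ i i
  have hb : ∑ i, ∑ j, |(D.C t - D.C r) i j| = (t - r) * ∑ i, ∑ j, |σ r i j| := by
    rw [Finset.mul_sum]
    refine Finset.sum_congr rfl fun i _ => ?_
    rw [Finset.mul_sum]
    refine Finset.sum_congr rfl fun j _ => ?_
    rw [hSσ, abs_mul, abs_of_pos hh]
  have hb' : ∑ i, ∑ j, |(D.C t - D.C r) i j| = ∑ i, ∑ j, |D.C t i j - D.C r i j| := by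
    simp only [Matrix.sub_apply]
  have hquad : (1 / 2) * ∑ i, ∑ j, (D.C t - D.C r) i j * Ir r i j =
      (t - r) * ((1 / 2) * ∑ i, ∑ j, σ r i j * Ir r i j) := by
    simp_rw [hSσ]
    rw [Finset.mul_sum, Finset.mul_sum, Finset.mul_sum]
    refine Finset.sum_congr rfl fun i _ => ?_
    rw [Finset.mul_sum, Finset.mul_sum, Finset.mul_sum]
    refine Finset.sum_congr rfl fun j _ => ?_
    ring
  -- assemble
  rw [slope_def_field, Real.dist_eq]
  set Δ := u t - u r - (1 / 2) * ∑ i, ∑ j, (D.C t - D.C r) i j * Ir r i j with hΔ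
  set A := (1 / 2) * ∑ i, ∑ j, σ r i j * Ir r i j with hAdef
  have hq : (u r - u t) / (r - t) - L = Δ / (t - r) + (A - L) := by
    have hne : r - t ≠ 0 := sub_ne_zero.2 hrt.ne
    have hne' : t - r ≠ 0 := hh.ne'
    rw [hΔ, hquad]
    field_simp
    ring
  have hΔle : |Δ| / (t - r) ≤ ε₁ * ∑ i, σ r i i +
      2 * M / δ ^ 2 * K4 * ((∑ i, ∑ j, |D.C t i j - D.C r i j|) * ∑ i, ∑ j, |σ r i j|) := by
    rw [div_le_iff₀ hh]
    have hE' : |Δ| ≤ ε₁ * ((t - r) * ∑ i, σ r i i) +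
        2 * M / δ ^ 2 * (((t - r) * ∑ i, ∑ j, |σ r i j|) *
          (∑ i, ∑ j, |D.C t i j - D.C r i j|) * K4) := by
      have h := hE
      rw [ha] at h
      calc |Δ| ≤ ε₁ * ((t - r) * ∑ i, σ r i i) +
            2 * M / δ ^ 2 * ((∑ i, ∑ j, |(D.C t - D.C r) i j|) ^ 2 * K4) := h
        _ = _ := by rw [pow_two, hb, ← hb, hb']; ring_nf
    calc |Δ| ≤ _ := hE'
      _ = _ := by ring
  have hA' : |A - L| < ε₀ / 4 := by rwa [Real.dist_eq] at hr1
  calc |(u r - u t) / (r - t) - L| = |Δ / (t - r) + (A - L)| := by rw [hq]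
    _ ≤ |Δ / (t - r)| + |A - L| := abs_add_le _ _
    _ = |Δ| / (t - r) + |A - L| := by rw [abs_div, abs_of_pos hh]
    _ ≤ ε₁ * ∑ i, σ r i i +
        2 * M / δ ^ 2 * K4 * ((∑ i, ∑ j, |D.C t i j - D.C r i j|) * ∑ i, ∑ j, |σ r i j|) +
        |A - L| := by gcongr
    _ < ε₁ * T + ε₀ / 4 + ε₀ / 4 := by gcongr
    _ = ε₀ / 4 + ε₀ / 4 + ε₀ / 4 := by rw [hε₁]; field_simp
    _ < ε₀ := by linarith

/-- **[BBD] Proposition 5 — the heat equation** `∂_t E_{C_t}[G(φ+ζ)] = ½ E_{C_t}[(Δ_{Ċ_t}G)(φ+ζ)]`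
at every `t > 0`, for a covariance decomposition with possibly degenerate positive semidefinite
`Ċ_t` and `G` bounded with bounded, uniformly continuous second derivative («for a `C²` function
`F`, let `F_t = P_{C_t} ∗ F` … then `∂_t F_t = ½ Δ_{Ċ_t} F_t`»; here `Δ_{Ċ} = Σ_{ij} Ċ^{ij}∂_i∂_j`
acts on `G` under the Gaussian average, [BBD] (e:DeltaC)).  Hypotheses beyond the printed `C²`:
`G` bounded, `D²G` bounded and uniformly continuous (all satisfied by `e^{−V₀}` for `V₀` bounded
below with bounded uniformly continuous derivatives up to order two).
-- TODO(general form): `G ∈ C²` of polynomial growth; the derivative as `½ Δ_{Ċ_t}` applied to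
--   `F_t` itself (differentiation under the Gaussian integral).
[cite: BauerschmidtBodineauDagallier2023, Proposition 5] -/
theorem hasDerivAt_integral_gaussian {G : EuclideanSpace ℝ (Fin N) → ℝ}
    {D1 : EuclideanSpace ℝ (Fin N) → EuclideanSpace ℝ (Fin N) →L[ℝ] ℝ}
    {D2 : EuclideanSpace ℝ (Fin N) → EuclideanSpace ℝ (Fin N) →L[ℝ] EuclideanSpace ℝ (Fin N) →L[ℝ] ℝ}
    (h1 : ∀ x, HasFDerivAt G (D1 x) x) (h2 : ∀ x, HasFDerivAt D1 (D2 x) x)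
    {K0 : ℝ} (hG : ∀ x, |G x| ≤ K0) {M : ℝ} (hM : ∀ x, ‖D2 x‖ ≤ M) (hUC : UniformContinuous D2)
    {t : ℝ} (ht : 0 < t) (φ : EuclideanSpace ℝ (Fin N)) :
    HasDerivAt (fun s => ∫ x, G (φ + x) ∂(multivariateGaussian 0 (D.C s)))
      ((1 / 2) * ∑ i, ∑ j, D.Cdot t i j *
        ∫ x, D2 (φ + x) (EuclideanSpace.single i 1) (EuclideanSpace.single j 1)
          ∂(multivariateGaussian 0 (D.C t))) t := by
  have hl := hasDerivWithinAt_integral_gaussian_Iic D h1 h2 hG hM hUC ht φ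
  have hr := hasDerivWithinAt_integral_gaussian_Ici D h1 h2 hG hM hUC ht.le φ
  have h := hl.union hr
  rw [Iic_union_Ici] at h
  exact hasDerivWithinAt_univ.mp h

end Heat

end Polchinski

end Literature.Analysis.FunctionSpaces

end
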